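import Literature.MathematicalPhysics.QuantumLattice.FockMapOp
import Literature.MathematicalPhysics.QuantumLattice.HubbardWave0LiebProofs
import HarnessLib

/-!
# Lattice symmetries in Lieb's two-species coordinates: `W(Γ_f ψ) = M_f · W(ψ) · M_fᵀ`

Topic `MathematicalPhysics/QuantumLattice`; part of the definition request `defn-fockMapOp` (API
(iv): "action on Lieb's coefficient matrix ... with ONE signed permutation matrix `M` on
`Config Λ n`, same for both spins"), for route HubbardSuperconductivity/PositivityPins, item
`TraceLemma` (step (c): `W ↦ M W M⁻¹`, hence `Tr (M W M⁻¹) = Tr W`).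

Lieb (PRL 62 (1989) 1201, proof of Theorem 1) expands a Fock vector of the Hubbard model as
`ψ = Σ_{α,β} W_{αβ} ψ^α_↑ ⊗ ψ^β_↓` over spinless occupation states; in the tree
`W = liebW n ψ`, `W_{αβ} = σ(α,β) ψ(α↑ ∪ β↓)` with Lieb's sign `σ = pairSign`
(`HubbardLiebConfig`). A site bijection `f : Λ ≃ Λ'` acts on Fock space by the second-quantised
operator `Γ_f = fockMapOp (Orb.mapEquiv f)` (`FockMapOp.lean`; `c†_{xσ} ↦ c†_{f x, σ}`), and on
`n`-site configurations by the signed permutation matrix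
`(M_f)_{α',α} = ε_f(α) [α' = f α]` (`configRelabel f n`, the spinless `Γ(f) = relabelMatrix f`
restricted to `Config Λ n`). We PROVE

* `liebW_fockMapOp_mapEquiv_mulVec : liebW n (Γ_f ψ) = M_f * liebW n ψ * M_fᵀ` — the SAME `M_f`
  on both sides (both spin species are relabelled by the same site bijection);
* `configRelabel_mul_transpose`, `transpose_configRelabel_mul` : `M_f M_fᵀ = M_fᵀ M_f = 1`,
  `star_configRelabel_apply` (real entries), so `M_fᵀ = M_f⁻¹ = M_fᴴ`;
* `trace_liebW_fockMapOp_mapEquiv_mulVec : Tr W(Γ_f ψ) = Tr W(ψ)` for a site permutation.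

The content is the SIGN IDENTITY `relabelSign_mapEquiv_pairSet`:
`ε_F(α↑ ∪ β↓) = ε_f(α) ε_f(β) σ(α,β) σ(fα,fβ)` for `F = Orb.mapEquiv f`, proved from the
pair-weight product formula `relabelSign_eq_prod` (`HyperoctahedralFockAction`) by splitting the
double product over `(α↑ ∪ β↓)²` into its four spin blocks: the diagonal blocks are the site signs,
and a mixed pair `{a↑, b↓}` is inverted by `F` exactly when the orders of `(a, b)` and `(f a, f b)`
disagree (`invWeight_mapEquiv_orb_zero_one_mul`).

## References

* E. H. Lieb, *Two theorems on the Hubbard model*, Phys. Rev. Lett. 62 (1989) 1201, proof of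
  Theorem 1 (the matrix `W`, "the Hamiltonian is symmetric between the up and the down spins").
  [LiebPRL1989]
* F. H. L. Essler et al., *The One-Dimensional Hubbard Model*, CUP 2005, §2.2.1–2.2.2 (site
  permutations second-quantised spin by spin, `Û = Û_↑ Û_↓`, eq. (2.43)). [EsslerEtAl2005]
-/

noncomputable section

namespace Literature.MathematicalPhysics.QuantumLattice

open Matrix Finset

/-! ### Lattice symmetries in Lieb's two-species coordinates: `W(Γ_f ψ) = M_f W(ψ) M_fᵀ` -/

section LiebW

variable {Λ Λ' : Type*} [LinearOrder Λ] [LinearOrder Λ'] [Fintype Λ] [Fintype Λ']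

/-- A site bijection maps the two-species configuration `α↑ ∪ β↓` to `(f α)↑ ∪ (f β)↓`. [folklore] -/
theorem finsetCongr_mapEquiv_pairSet (f : Λ ≃ Λ') (α β : Finset Λ) :
    (Orb.mapEquiv f).finsetCongr (pairSet α β) = pairSet (f.finsetCongr α) (f.finsetCongr β) := by
  ext i
  simp only [Equiv.finsetCongr_apply, Finset.mem_map_equiv, mem_pairSet]
  exact Iff.rfl

/-- The coefficient of `Γ(e) ψ` on the relabelled configuration `e S` is `ε_e(S) ψ(S)`. [folklore] -/
theorem fockMapOp_equiv_mulVec_apply_finsetCongr {ι κ : Type*} [LinearOrder ι] [Fintype ι]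
    [LinearOrder κ] [Fintype κ] (e : ι ≃ κ) (ψ : Fock ι) (S : Finset ι) :
    (fockMapOp e *ᵥ ψ) (e.finsetCongr S) = relabelSign e S * ψ S := by
  rw [fockMapOp_equiv]
  simp only [mulVec, dotProduct, relabelMatrix_apply_finsetCongr, ite_mul, zero_mul,
    Finset.sum_ite_eq, Finset.mem_univ, if_true]

omit [Fintype Λ] [Fintype Λ'] in
/-- Pair weights of the orbital bijection on two up orbitals are the site pair weights. [folklore] -/
theorem invWeight_mapEquiv_orb_zero_zero (f : Λ ≃ Λ') (a a' : Λ) :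
    invWeight (Orb.mapEquiv f) (orb a 0) (orb a' 0) = invWeight f a a' := by
  simp only [invWeight, Orb.mapEquiv_orb, orb_lt_orb_zero_iff]

omit [Fintype Λ] [Fintype Λ'] in
/-- Pair weights of the orbital bijection on two down orbitals are the site pair weights. [folklore] -/
theorem invWeight_mapEquiv_orb_one_one (f : Λ ≃ Λ') (b b' : Λ) :
    invWeight (Orb.mapEquiv f) (orb b 1) (orb b' 1) = invWeight f b b' := by
  simp only [invWeight, Orb.mapEquiv_orb, orb_lt_orb_one_iff, one_ne_zero, and_false, or_false]

omit [Fintype Λ] [Fintype Λ'] in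
/-- **The mixed pair weights**: for an up orbital `a↑` and a down orbital `b↓`, the product of the
two ordered pair weights of `Orb.mapEquiv f` is `(-1)^{[b<a]} (-1)^{[f b<f a]}` — the factor by
which Lieb's sign `σ(α, β)` changes under the relabelling. [folklore] -/
theorem invWeight_mapEquiv_orb_zero_one_mul (f : Λ ≃ Λ') (a b : Λ) :
    invWeight (Orb.mapEquiv f) (orb a 0) (orb b 1) * invWeight (Orb.mapEquiv f) (orb b 1) (orb a 0) =
      (if b < a then (-1 : ℂ) else 1) * (if f b < f a then (-1 : ℂ) else 1) := by
  simp only [invWeight, Orb.mapEquiv_orb, orb_lt_orb_zero_iff, orb_lt_orb_one_iff]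
  rcases lt_trichotomy a b with hab | rfl | hab
  · -- `a < b`
    have h1 : ¬b < a := not_lt.2 hab.le
    simp [hab, h1]
  · simp
  · -- `b < a`
    have h1 : ¬a < b := not_lt.2 hab.le
    have h2 : a ≠ b := hab.ne'
    have hne : f a ≠ f b := fun h => h2 (f.injective h)
    rcases lt_or_gt_of_ne hne with hf | hf
    · simp [hab, h1, h2, hf, lt_asymm hf, hne]
    · simp [hab, h1, h2, hf, lt_asymm hf]

omit [Fintype Λ] in
/-- Lieb's sign as a product of pair weights: `σ(α, β) = ∏_{a ∈ α} ∏_{b ∈ β} (-1)^{[b < a]}`.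
[cite: LiebPRL1989, proof of Theorem 1] -/
theorem pairSign_eq_prod_prod_ite (α β : Finset Λ) :
    pairSign α β = ∏ a ∈ α, ∏ b ∈ β, if b < a then (-1 : ℂ) else 1 := by
  rw [pairSign]
  refine Finset.prod_congr rfl fun a _ => ?_
  rw [jwSign, neg_one_pow_card_filter]

omit [Fintype Λ] [Fintype Λ'] [LinearOrder Λ] in
/-- Lieb's sign of the relabelled configurations, pulled back to `α × β`. [folklore] -/
theorem pairSign_finsetCongr_eq_prod (f : Λ ≃ Λ') (α β : Finset Λ) :
    pairSign (f.finsetCongr α) (f.finsetCongr β) =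
      ∏ a ∈ α, ∏ b ∈ β, if f b < f a then (-1 : ℂ) else 1 := by
  rw [pairSign_eq_prod_prod_ite, Equiv.finsetCongr_apply, Equiv.finsetCongr_apply, Finset.prod_map]
  refine Finset.prod_congr rfl fun a _ => ?_
  rw [Finset.prod_map]
  rfl

omit [Fintype Λ'] in
/-- **The sign identity behind `W ↦ M W Mᵀ`.** The relabelling sign of the orbital bijection
`(x, σ) ↦ (f x, σ)` on a two-species configuration factorises as
`ε_F(α↑ ∪ β↓) = ε_f(α) · ε_f(β) · σ(α, β) · σ(f α, f β)`: inversions inside the up block and inside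
the down block give the two site signs, and a mixed pair `{a↑, b↓}` is inverted exactly when the
order of `a, b` and that of `f a, f b` disagree. [folklore] -/
theorem relabelSign_mapEquiv_pairSet (f : Λ ≃ Λ') (α β : Finset Λ) :
    relabelSign (Orb.mapEquiv f) (pairSet α β) =
      relabelSign f α * relabelSign f β * (pairSign α β * pairSign (f.finsetCongr α) (f.finsetCongr β)) := by
  -- the two embedded copies `α↑`, `β↓`
  set u : Λ ↪ Orb Λ := ⟨fun x => orb x 0, fun x y h => by simpa using congrArg (fun i => (ofLex i).1) h⟩
    with hu
  set d : Λ ↪ Orb Λ := ⟨fun x => orb x 1, fun x y h => by simpa using congrArg (fun i => (ofLex i).1) h⟩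
    with hd
  have hS : pairSet α β = α.map u ∪ β.map d := pairSet_eq_union_map α β
  have hdisj : Disjoint (α.map u) (β.map d) := by
    rw [Finset.disjoint_left]
    intro i hi hi'
    simp only [Finset.mem_map] at hi hi'
    obtain ⟨x, -, rfl⟩ := hi
    obtain ⟨y, -, hy⟩ := hi'
    simpa [hu, hd] using congrArg (fun i => (ofLex i).2) hy
  set F := Orb.mapEquiv f with hF
  -- split the double product over `S × S` into the four blocks
  rw [relabelSign_eq_prod, hS, Finset.prod_union hdisj]
  have hsplit : ∀ j, ∏ k ∈ α.map u ∪ β.map d, invWeight F j k =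
      (∏ a ∈ α, invWeight F j (orb a 0)) * ∏ b ∈ β, invWeight F j (orb b 1) := by
    intro j
    rw [Finset.prod_union hdisj, Finset.prod_map, Finset.prod_map]
    rfl
  simp only [hsplit, Finset.prod_mul_distrib, Finset.prod_map]
  -- evaluate the four blocks
  have hAA : ∏ a ∈ α, ∏ a' ∈ α, invWeight F (u a) (orb a' 0) = relabelSign f α := by
    rw [relabelSign_eq_prod]
    refine Finset.prod_congr rfl fun a _ => Finset.prod_congr rfl fun a' _ => ?_
    exact invWeight_mapEquiv_orb_zero_zero f a a'
  have hBB : ∏ b ∈ β, ∏ b' ∈ β, invWeight F (d b) (orb b' 1) = relabelSign f β := by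
    rw [relabelSign_eq_prod]
    refine Finset.prod_congr rfl fun b _ => Finset.prod_congr rfl fun b' _ => ?_
    exact invWeight_mapEquiv_orb_one_one f b b'
  have hBA : ∏ b ∈ β, ∏ a ∈ α, invWeight F (d b) (orb a 0) =
      ∏ a ∈ α, ∏ b ∈ β, invWeight F (orb b 1) (orb a 0) := Finset.prod_comm
  rw [hAA, hBB, hBA, pairSign_eq_prod_prod_ite, pairSign_finsetCongr_eq_prod]
  -- the mixed blocks, pointwise
  have hmixed : (∏ a ∈ α, ∏ b ∈ β, invWeight F (u a) (orb b 1)) *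
      ∏ a ∈ α, ∏ b ∈ β, invWeight F (orb b 1) (orb a 0) =
      (∏ a ∈ α, ∏ b ∈ β, if b < a then (-1 : ℂ) else 1) *
        ∏ a ∈ α, ∏ b ∈ β, if f b < f a then (-1 : ℂ) else 1 := by
    rw [← Finset.prod_mul_distrib, ← Finset.prod_mul_distrib]
    refine Finset.prod_congr rfl fun a _ => ?_
    rw [← Finset.prod_mul_distrib, ← Finset.prod_mul_distrib]
    refine Finset.prod_congr rfl fun b _ => ?_
    exact invWeight_mapEquiv_orb_zero_one_mul f a b
  linear_combination (relabelSign f α * relabelSign f β) * hmixed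

/-- **Lieb's matrix of a site bijection**: the signed permutation matrix
`(M_f)_{α', α} = ε_f(α) [α' = f α]` of `f` on `n`-site configurations — the spinless second
quantisation `Γ(f)` (`relabelMatrix f = fockMapOp f`) restricted to the `n`-particle
configurations; the SAME matrix serves both spin species. [cite: LiebPRL1989, proof of Theorem 1] -/
def configRelabel (f : Λ ≃ Λ') (n : ℕ) : Matrix (Config Λ' n) (Config Λ n) ℂ :=
  fun α' α => relabelMatrix f α'.1 α.1

/-- The bijection of `n`-configurations induced by a site bijection. [folklore] -/
def configCongr (f : Λ ≃ Λ') (n : ℕ) : Config Λ n ≃ Config Λ' n :=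
  f.finsetCongr.subtypeEquiv fun s => by rw [Equiv.finsetCongr_apply, Finset.card_map]

omit [Fintype Λ] [Fintype Λ'] [LinearOrder Λ] [LinearOrder Λ'] in
/-- `configCongr` relabels the underlying set. [folklore] -/
@[simp] theorem configCongr_apply_val (f : Λ ≃ Λ') (n : ℕ) (α : Config Λ n) :
    (configCongr f n α).1 = f.finsetCongr α.1 := rfl

omit [Fintype Λ] [Fintype Λ'] in
/-- Entries of `M_f` in the relabelled row basis: `(M_f)_{f α, α₁} = δ_{α α₁} ε_f(α)`. [folklore] -/
theorem configRelabel_apply_configCongr (f : Λ ≃ Λ') (n : ℕ) (α α₁ : Config Λ n) :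
    configRelabel f n (configCongr f n α) α₁ = if α = α₁ then relabelSign f α₁.1 else 0 := by
  rw [configRelabel, configCongr_apply_val, relabelMatrix_apply_finsetCongr]
  simp only [Subtype.val_inj]

/-- `M_f` is the spinless `fockMapOp f` on `n`-configurations. [folklore] -/
theorem configRelabel_eq_fockMapOp_apply (f : Λ ≃ Λ') (n : ℕ)
    (α' : Config Λ' n) (α : Config Λ n) : configRelabel f n α' α = fockMapOp f α'.1 α.1 := by
  rw [configRelabel, fockMapOp_equiv]

omit [Fintype Λ] [Fintype Λ'] in
/-- `M_f` is real. [folklore] -/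
theorem star_configRelabel_apply (f : Λ ≃ Λ') (n : ℕ) (α' : Config Λ' n) (α : Config Λ n) :
    star (configRelabel f n α' α) = configRelabel f n α' α := by
  simp only [configRelabel, relabelMatrix]
  split_ifs
  · exact star_relabelSign f α.1
  · exact star_zero _

omit [Fintype Λ'] in
/-- **`M_f` is orthogonal**: `M_f M_fᵀ = 1`. [cite: LiebPRL1989, proof of Theorem 1] -/
theorem configRelabel_mul_transpose (f : Λ ≃ Λ') (n : ℕ) :
    configRelabel f n * (configRelabel f n)ᵀ = 1 := by
  ext α' β'
  obtain ⟨α, rfl⟩ := (configCongr f n).surjective α'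
  obtain ⟨β, rfl⟩ := (configCongr f n).surjective β'
  simp only [Matrix.mul_apply, transpose_apply, configRelabel_apply_configCongr, ite_mul, zero_mul,
    Finset.sum_ite_eq, Finset.mem_univ, if_true, Matrix.one_apply,
    (configCongr f n).injective.eq_iff]
  by_cases h : α = β
  · subst h
    simp [relabelSign_mul_self]
  · simp [h, Ne.symm h]

/-- `M_fᵀ M_f = 1`. [cite: LiebPRL1989, proof of Theorem 1] -/
theorem transpose_configRelabel_mul (f : Λ ≃ Λ') (n : ℕ) :
    (configRelabel f n)ᵀ * configRelabel f n = 1 := by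
  ext α β
  rw [Matrix.mul_apply, ← (configCongr f n).sum_comp]
  simp only [transpose_apply, configRelabel_apply_configCongr, ite_mul, zero_mul,
    Finset.sum_ite_eq', Finset.mem_univ, if_true, Matrix.one_apply]
  by_cases h : α = β
  · subst h
    simp [relabelSign_mul_self]
  · simp [h]

/-- **Lattice symmetries act on Lieb's coefficient matrix by `W ↦ M W Mᵀ`** with ONE signed
permutation matrix `M = M_f` for both spin species: for a site bijection `f` and every Fock vector
`ψ`, `W(Γ_f ψ) = M_f W(ψ) M_fᵀ` (`Γ_f = fockMapOp (Orb.mapEquiv f)`: each `c†_{xσ}` is replaced by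
`c†_{f x, σ}` in `ψ = Σ W_{αβ} ψ^α_↑ ⊗ ψ^β_↓`). With `M_f M_fᵀ = 1` this gives
`Tr W(Γ_f ψ) = Tr W(ψ)` and the covariance of Lieb's positivity argument.
[cite: LiebPRL1989, proof of Theorem 1] -/
theorem liebW_fockMapOp_mapEquiv_mulVec (f : Λ ≃ Λ') (n : ℕ) (ψ : Fock (Orb Λ)) :
    liebW n (fockMapOp (Orb.mapEquiv f) *ᵥ ψ) =
      configRelabel f n * liebW n ψ * (configRelabel f n)ᵀ := by
  ext α' β'
  obtain ⟨α, rfl⟩ := (configCongr f n).surjective α'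
  obtain ⟨β, rfl⟩ := (configCongr f n).surjective β'
  -- right-hand side: the double sum collapses to `ε(α) W_{αβ} ε(β)`
  have hR : (configRelabel f n * liebW n ψ * (configRelabel f n)ᵀ) (configCongr f n α)
      (configCongr f n β) = relabelSign f α.1 * liebW n ψ α β * relabelSign f β.1 := by
    simp only [Matrix.mul_apply, transpose_apply, configRelabel_apply_configCongr, ite_mul, zero_mul,
      mul_ite, mul_zero, Finset.sum_ite_eq, Finset.mem_univ, if_true]
  rw [hR, liebW_apply, liebW_apply, configCongr_apply_val, configCongr_apply_val,
    ← finsetCongr_mapEquiv_pairSet, fockMapOp_equiv_mulVec_apply_finsetCongr,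
    relabelSign_mapEquiv_pairSet]
  linear_combination (relabelSign f α.1 * relabelSign f β.1 * pairSign α.1 β.1 * ψ (pairSet α.1 β.1)) *
    LiebThm1.pairSign_mul_self (f.finsetCongr α.1) (f.finsetCongr β.1)

/-- **The trace of Lieb's matrix is invariant under lattice symmetries**:
`Tr W(Γ_f ψ) = Tr W(ψ)` for a site permutation `f`. [cite: LiebPRL1989, proof of Theorem 1] -/
theorem trace_liebW_fockMapOp_mapEquiv_mulVec (f : Equiv.Perm Λ) (n : ℕ) (ψ : Fock (Orb Λ)) :
    (liebW n (fockMapOp (Orb.mapEquiv f) *ᵥ ψ)).trace = (liebW n ψ).trace := by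
  rw [liebW_fockMapOp_mapEquiv_mulVec, Matrix.trace_mul_cycle, transpose_configRelabel_mul,
    Matrix.one_mul]

end LiebW

end Literature.MathematicalPhysics.QuantumLattice
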